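import Summits.BirchSwinnertonDyer.BirchSwinnertonDyer.Theses.SignedBaseChange
import Literature.NumberTheory.EllipticCurves.CastellaCiperianiSkinnerSprung2018.AnticyclotomicHowardDivisibilityOPEN
import Literature.NumberTheory.EllipticCurves.YanZhu2026.GreenbergMainTheoremsAnyRoot
import Summits.BirchSwinnertonDyer.Rank1Residual.Partition.IrreducibleOverQuadraticField
import HarnessLib

/-!
# Stub TS1 `stub_xAcTorsionSS` of line `bdpline` (v12–v14) on crux `AnticyclotomicEisensteinDivisibility`
# (stmt-BirchSwinnertonDyer-20727) is PRINT: closed modulo the tree's PRE binder CCSS18 Thm. 5.7 / Lemma 5.5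

Helper file (`--supports stmt-BirchSwinnertonDyer-20727`) of the lead-prover seat bsd-line-sbc-p1 (gen 2). The registered stub
`stub_xAcTorsionSS` (one-variable torsion: `X_ac = AcSelmer.XAc (W.baseChange K) p κ₂ v̄ ∅ γ₂` is `Λ_ac`-torsion at a good
supersingular `p ≥ 5` under `Surj`, classical Heegner `K`, any `N`; adopted from the ideator's splice `torsplice`) is, by name, a
consequence of the tree's PRE binder
`CastellaCiperianiSkinnerSprung2018.thm57_lemma55_exists_isBDPLFunction_isTorsion_mem_charIdeal_OPEN` (arXiv:1804.10993 Thm. 5.7 +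
Lemma 5.5: rank one of the signed Selmer modules ⟹ `𝔛^{rel,str}` torsion, the SAME object dictionary as BCS25's `X_Gr`), whose
hypotheses are the crux's: `p ≠ 2`, `GoodSS W p` (⟸ good + `a_p = 0`), imaginary quadratic `K` with the classical Heegner
hypothesis (= the split-primes binder), (spl), (irr_K) (⟸ `Surj`, `Rank1Residual.irrK_of_surj`), the `ι`-compatible prime `v`,
`v̄ ∋ p`, `v̄ ≠ v`, `κ₂` anticyclotomic. The REFEREED form of the same argument is Castella–Wan, Math. Ann. (2023/24) =
arXiv:1607.02019, Lemma 5.11 + Thm. 5.12 (any `N⁺`; not yet typed — a typer's task; the tree's `XAc … ∅` is the dual of a SMALLER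
group than CW's `Sel^{rel,str}` — locally trivial rather than unramified away from `p` — so print ⟹ stub). Nothing about elliptic
curves is asserted unconditionally here: the binder is a hypothesis.
-/

-- D-0017: single-problem summit, the namespace repeats the problem name by design.
set_option linter.dupNamespace false
set_option autoImplicit false

noncomputable section

open scoped Classical

namespace Summit.BirchSwinnertonDyer.BirchSwinnertonDyer.Theorems.SignedBaseChangeAcDivXAcTorsion

open Summit.BirchSwinnertonDyer.BirchSwinnertonDyer.Theses.SignedBaseChange
open NumberField IsDedekindDomain Field CongruenceSubgroup
  Literature.NumberTheory.EllipticCurves Literature.NumberTheory.EllipticCurves.ModularForms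
  Literature.NumberTheory.EllipticCurves.Rank1Residual Literature.NumberTheory.EllipticCurves.YanZhu2026

/-- **TS1 modulo CCSS18**: the text of the registered stub `stub_xAcTorsionSS` of `Lines/bdpline.lean` (v12–v14), VERBATIM, from
the PRE binder `thm57_lemma55_exists_isBDPLFunction_isTorsion_mem_charIdeal_OPEN` (its torsion conjunct), instantiated at
`κ = κ₂`, `γ = γ₂`, `𝔭 = v̄`; `GoodSS` from good reduction and `a_p = 0`, (irr_K) from `Surj`.
[claim: CastellaCiperianiSkinnerSprung2018, status: under-review]
[cite: CastellaCiperianiSkinnerSprung2018, Thm. 5.7 and Lemma 5.5 (arXiv:1804.10993v2 §5.1, pp. 21–23)] -/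
theorem xAcTorsionSS_of_CCSS18
    (h57 : CastellaCiperianiSkinnerSprung2018.thm57_lemma55_exists_isBDPLFunction_isTorsion_mem_charIdeal_OPEN) :
    SignedTwoVariableInputs → Literature.NumberTheory.EllipticCurves.ModularForms.nonempty_modularParametrizationData → ∀ (W : WeierstrassCurve ℚ) [W.IsElliptic] [W.IsGloballyMinimal] (p : ℕ) [Fact p.Prime], 5 ≤ p → W.HasGoodReductionAtPrime p → W.frobeniusTrace p = 0 → Literature.NumberTheory.EllipticCurves.Rank1Residual.Surj W p → ∀ (K : Type) [Field K] [NumberField K] (ι : PadicAlgCl p ≃+* ℂ) (v vbar : IsDedekindDomain.HeightOneSpectrum (NumberField.RingOfIntegers K)) (κ₁ κ₂ : Literature.NumberTheory.EllipticCurves.ZpExtension K p) (γ₁ γ₂ : Field.absoluteGaloisGroup K) [Fact (Literature.NumberTheory.EllipticCurves.ZpExtension.IsTopGeneratorPair κ₁ κ₂ γ₁ γ₂)] [NeZero (NumberField.discr K).natAbs] (N : ℕ) [NeZero N] (f : CuspForm (CongruenceSubgroup.Gamma0 N) 2), Literature.NumberTheory.EllipticCurves.ModularForms.IsNewformOf W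 f → (N : ℤ) = W.conductorNorm ℤ → Literature.NumberTheory.EllipticCurves.IsImaginaryQuadratic K → ((Ideal.span {(p : ℤ)}).primesOver (NumberField.RingOfIntegers K)).ncard = 2 → ((p : ℕ) : NumberField.RingOfIntegers K) ∈ v.asIdeal → ((p : ℕ) : NumberField.RingOfIntegers K) ∈ vbar.asIdeal → vbar ≠ v → (∀ (w : NumberField.InfinitePlace K) (k : NumberField.RingOfIntegers K), k ∈ v.asIdeal ↔ ‖ι.symm (w.embedding (k : K))‖ < 1) → IsCoprime (N : ℤ) (NumberField.discr K) → (∀ ℓ : ℕ, ℓ.Prime → ℓ ∣ N → ((Ideal.span {(ℓ : ℤ)}).primesOver (NumberField.RingOfIntegers K)).ncard = 2) → Odd (NumberField.discr K) → NumberField.discr K ≠ -3 → κ₁.IsCyclotomic → κ₂.IsAnticyclotomic → (haveI : Fact (κ₂.IsTopGenerator γ₂) := ⟨Literature.NumberTheory.EllipticCurves.YanZhu2026.isTopGenerator_of_pair (κ₁ := κ₁) (γ₁ := γ₁)⟩; Module.IsTorsion (Literature.NumberTheory.EllipticCurves.IwasawaAlgebra p) (Literature.NumberTheory.EllipticCurves.Castella2018.AcSelmer.XAc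 (W.baseChange K) p κ₂ vbar ∅ γ₂)) := by
  intro _ _ W _ _ p _ hp hgood ha0 hs K _ _ ι v vbar κ₁ κ₂ γ₁ γ₂ _ _ N _ f hf _ hK hsplit _ hvbar hvv hι _ hHeeg _
    _ _ hκ₂
  have hp2 : p ≠ 2 := by omega
  have hss : GoodSS W p := ⟨hgood, by rw [ha0]; exact dvd_zero _⟩
  have hirr : (W.baseChange K).HasIrreducibleModPGaloisRep p :=
    Summit.BirchSwinnertonDyer.Rank1Residual.irrK_of_surj W p hs K hK.1
  haveI : Fact (κ₂.IsTopGenerator γ₂) := ⟨isTopGenerator_of_pair (κ₁ := κ₁) (γ₁ := γ₁)⟩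
  obtain ⟨-, -, -, -, -, htors, -⟩ := h57 ι W K v vbar κ₂ γ₂ hf hp2 hss hK hHeeg hsplit hirr hι hvbar hvv hκ₂
  exact htors

end Summit.BirchSwinnertonDyer.BirchSwinnertonDyer.Theorems.SignedBaseChangeAcDivXAcTorsion

end
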